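import Mathlib
import Summits.NavierStokesRegularity.NavierStokesRegularity.Theorems.EulerZoomLiouvillePowerGaugeEulerLiouvilleCondenserLengthArea
import Summits.NavierStokesRegularity.NavierStokesRegularity.Theorems.EulerZoomLiouvillePowerGaugeEulerLiouvilleCondenserSectorDichotomy

/-!
# THE CONDENSER CORE in the chart: an anomalous value forces an exponentially large gradient (ROUND-42 (B3)+(B4))

Width piece for crux `EulerZoomLiouville.PowerGaugeEulerLiouville` (stmt-NavierStokesRegularity-19832), by name under
LEAD 19832 (ns-typeII-p2 g12); seat ns-ezl-w2 g3, `--supports stmt-NavierStokesRegularity-19832 --as helper`.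
Composition of t42-LA (`pi_mul_sq_le_log_mul_integral`) and t42-SD (`pi_le_volume_shortDirections`) with the mean-value
step (B4), entirely in the polar chart of `ℝ × ℝ` (Mathlib + the two chart files):

* `norm_sub_le_mul_of_ray` — `‖g(w u_θ) − g(0)‖ ≤ G'·w` when `‖Dg‖ ≤ G'` on the disc (ray form of the mean-value inequality).
* **`exp_le_gradient_or_small` — THE CORE**: `g ∈ C¹(ℝ × ℝ, F)`, `‖g 0‖ ≥ m > 0` (an ANOMALOUS value at the centre),
  `‖Dg‖ ≤ G_m` on the closed chart disc of radius `r★`, budgets `∫ ‖g‖² ≤ A` and `∫ ‖Dg‖² ≤ E` on the square `[−r★,r★]²`, and ROOM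
  `8A/(π m²) ≤ (3/4) r★²`.  Then
  `(m/(4 r★))·exp(π m²/(16 E)) ≤ G_m  ∨  π m²/(16 E) ≤ log 2`.
  [`G' := max G_m (m/(2r★))`, `w₀ := m/(4G') ≤ r★/2`; on the circle of radius `w₀`, `‖g‖ ≥ 3m/4` (mean value); the long
  directions are few (t42-SD with `a ≤ A`), so t42-LA gives `π m²/16 ≤ log(r★/w₀)·E`, i.e. `w₀ ≤ r★ e^{−π m²/(16E)}`, i.e.
  `G' ≥ (m/(4r★)) e^{π m²/(16E)}`; the second disjunct is the case `G' = m/(2r★)`.]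

MEANING (nsreg-p2 g33's THEOREM B, flat): with `g = V ∘ (affine isometric chart of the quiet plane Π_s centred at the first
hit y_s)`, `m = γ s ≥ γR`, `A ≲ C_A R^{−2ρ}`, `E ≲ C_E R^{−ρ}` this reads `sup_{B(0,3R)}‖DV‖ ≥ c₁ R^{1+…} exp(c₂ γ² R^{2+ρ}/C_E)`:
LEAVING `B(0,2R)` BACKWARDS COSTS A GRADIENT `exp(c·R^{2+ρ})` — the clock exponent `2+ρ` is the E-gauge's condenser exponent.

HONEST FRAMING: a lemma of real analysis in the plane; nothing here proves the crux E `PowerGaugeEulerLiouville` (19832 OPEN),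
any door Target, or any Navier–Stokes statement; MODEL lattice only (19832 is a crux CLASS — E/NS strata — not NS regularity).
[folklore (length–area method); cite: ConstantinIgnatovaVicol2026Putative, §3.4.1 for the setting]
-/

noncomputable section

open Set Filter Topology Metric Function MeasureTheory Real
open scoped RealInnerProductSpace

set_option linter.dupNamespace false

namespace Summit.NavierStokesRegularity.NavierStokesRegularity.Theorems.PowerGaugeEulerLiouville.Condenser

/-- **Mean value along a ray from the centre**: if `‖Dg(r u_θ)‖ ≤ G'` for `r ∈ [0, w]` then `‖g(w u_θ) − g(0)‖ ≤ G'·w`.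
[folklore] -/
theorem norm_sub_le_mul_of_ray {F : Type*} [NormedAddCommGroup F] [NormedSpace ℝ F] [CompleteSpace F]
    {g : ℝ × ℝ → F} (hg : ContDiff ℝ 1 g) {w G' : ℝ} (hw : 0 ≤ w) (θ : ℝ)
    (hG : ∀ r ∈ Icc 0 w, ‖fderiv ℝ g (polarCoord.symm (r, θ))‖ ≤ G') :
    ‖g (polarCoord.symm (w, θ)) - g 0‖ ≤ G' * w := by
  have h := norm_sub_le_integral_norm_fderiv_ray hg θ hw
  have h0 : polarCoord.symm ((0 : ℝ), θ) = (0 : ℝ × ℝ) := by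
    simp [polarCoord_symm_apply]
  rw [h0] at h
  refine h.trans ?_
  have hray : Continuous fun s : ℝ => polarCoord.symm (s, θ) :=
    continuous_iff_continuousAt.2 fun s => (hasDerivAt_polarCoord_symm_ray θ s).continuousAt
  have hcn : Continuous fun s : ℝ => ‖fderiv ℝ g (polarCoord.symm (s, θ))‖ :=
    ((hg.continuous_fderiv one_ne_zero).comp hray).norm
  calc ∫ r in (0 : ℝ)..w, ‖fderiv ℝ g (polarCoord.symm (r, θ))‖
      ≤ ∫ _ in (0 : ℝ)..w, G' :=
        intervalIntegral.integral_mono_on hw (hcn.intervalIntegrable 0 w) intervalIntegrable_const hG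
    _ = G' * w := by rw [intervalIntegral.integral_const, smul_eq_mul]; ring

/-- **THE CONDENSER CORE (chart form of ROUND-42 (B3)+(B4)).**  `g ∈ C¹(ℝ × ℝ, F)` with an anomalous value `‖g 0‖ ≥ m > 0`,
a gradient bound `‖Dg(r u_θ)‖ ≤ G_m` for `r ∈ [0, r★]`, budgets on the sup-norm square `closedBall 0 r★ = [−r★, r★]²`
`∫ ‖g‖² ≤ A`, `∫ ‖Dg‖² ≤ E`, and room
`8A/(π m²) ≤ (3/4)·r★²`.  Then `(m/(4r★))·exp(π m²/(16E)) ≤ G_m`, or else `π m²/(16E) ≤ log 2`.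
[folklore (length–area method); cite: ConstantinIgnatovaVicol2026Putative, §3.4.1 for the setting] -/
theorem exp_le_gradient_or_small {F : Type*} [NormedAddCommGroup F] [NormedSpace ℝ F] [CompleteSpace F]
    {g : ℝ × ℝ → F} (hg : ContDiff ℝ 1 g) {m rs Gm A E : ℝ} (hm : 0 < m) (hrs : 0 < rs)
    (h0 : m ≤ ‖g 0‖)
    (hGm : ∀ r ∈ Icc 0 rs, ∀ θ : ℝ, ‖fderiv ℝ g (polarCoord.symm (r, θ))‖ ≤ Gm)
    (hA : ∫ p in closedBall (0 : ℝ × ℝ) rs, ‖g p‖ ^ 2 ≤ A)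
    (hE : ∫ p in closedBall (0 : ℝ × ℝ) rs, ‖fderiv ℝ g p‖ ^ 2 ≤ E)
    (hroom : 8 * A / (Real.pi * m ^ 2) ≤ 3 / 4 * rs ^ 2) :
    m / (4 * rs) * Real.exp (Real.pi * m ^ 2 / (16 * E)) ≤ Gm ∨ Real.pi * m ^ 2 / (16 * E) ≤ Real.log 2 := by
  -- every swept sector lies in the sup-norm square `closedBall 0 r★`
  have hsq : ∀ (lo : ℝ) (T : Set ℝ), 0 ≤ lo →
      polarCoord.symm '' (Icc lo rs ×ˢ T) ⊆ closedBall (0 : ℝ × ℝ) rs := by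
    rintro lo T hlo _ ⟨⟨r, θ⟩, ⟨hr, _⟩, rfl⟩
    have hr0 : 0 ≤ r := hlo.trans hr.1
    rw [mem_closedBall, dist_zero_right, polarCoord_symm_apply, Prod.norm_def]
    refine max_le ?_ ?_
    · simp only [Real.norm_eq_abs, abs_mul, abs_of_nonneg hr0]
      exact (mul_le_of_le_one_right hr0 (Real.abs_cos_le_one θ)).trans hr.2
    · simp only [Real.norm_eq_abs, abs_mul, abs_of_nonneg hr0]
      exact (mul_le_of_le_one_right hr0 (Real.abs_sin_le_one θ)).trans hr.2
  -- the effective gradient bound `G'` and the inner radius `w₀`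
  set G' : ℝ := max Gm (m / (2 * rs)) with hG'
  have hG'pos : 0 < G' := lt_max_of_lt_right (by positivity)
  have hGmG' : Gm ≤ G' := le_max_left _ _
  set w₀ : ℝ := m / (4 * G') with hw₀
  have hw₀pos : 0 < w₀ := by positivity
  have hw₀le : w₀ ≤ rs / 2 := by
    rw [hw₀, div_le_iff₀ (by positivity)]
    have : m / (2 * rs) ≤ G' := le_max_right _ _
    rw [div_le_iff₀ (by positivity)] at this
    linarith
  have hw₀lt : w₀ < rs := by linarith
  -- continuity facts
  have hgc : Continuous g := hg.continuous
  have hGc : Continuous fun x : ℝ × ℝ => ‖fderiv ℝ g x‖ ^ 2 := ((hg.continuous_fderiv one_ne_zero).norm).pow 2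
  -- (B4) on the circle of radius `w₀`: `‖g‖ ≥ 3m/4`
  have hcircle : ∀ θ : ℝ, 3 * m / 4 ≤ ‖g (polarCoord.symm (w₀, θ))‖ := by
    intro θ
    have h1 : ‖g (polarCoord.symm (w₀, θ)) - g 0‖ ≤ G' * w₀ :=
      norm_sub_le_mul_of_ray hg hw₀pos.le θ fun r hr => (hGm r ⟨hr.1, hr.2.trans hw₀lt.le⟩ θ).trans hGmG'
    have h2 : G' * w₀ = m / 4 := by
      rw [hw₀]; field_simp
    have h3 := norm_sub_norm_le (g 0) (g (polarCoord.symm (w₀, θ)))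
    rw [norm_sub_rev] at h3
    linarith
  -- (B3a) the sector dichotomy: short directions have measure ≥ π
  set Θ : Set ℝ := {θ ∈ Ioo (-Real.pi) Real.pi | ∃ r ∈ Icc w₀ rs, ‖g (polarCoord.symm (r, θ))‖ ≤ m / 2} with hΘ
  have hΘm : MeasurableSet Θ := measurableSet_shortDirections hgc m w₀ rs
  have hΘsub : Θ ⊆ Ioo (-Real.pi) Real.pi := fun θ hθ => hθ.1
  have hgint : IntegrableOn (fun x : ℝ × ℝ => ‖g x‖ ^ 2) (closedBall (0 : ℝ × ℝ) rs) :=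
    (hgc.norm.pow 2).continuousOn.integrableOn_compact (isCompact_closedBall 0 rs)
  have ha : ∫ p in polarCoord.symm '' (Icc w₀ rs ×ˢ Ioo (-Real.pi) Real.pi), ‖g p‖ ^ 2 ≤ A :=
    (setIntegral_mono_set hgint (Filter.Eventually.of_forall fun x => sq_nonneg _)
      (ae_of_all _ (hsq w₀ _ hw₀pos.le))).trans hA
  have hroom' : 8 * A / (Real.pi * m ^ 2) ≤ rs ^ 2 - w₀ ^ 2 := by
    have : w₀ ^ 2 ≤ (rs / 2) ^ 2 := pow_le_pow_left₀ hw₀pos.le hw₀le 2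
    nlinarith
  have hΘvol : ENNReal.ofReal Real.pi ≤ volume Θ := pi_le_volume_shortDirections hgc hm hw₀pos hw₀lt ha hroom'
  -- (B3b) the length–area lemma on the short directions
  have hEint : IntegrableOn (fun x : ℝ × ℝ => ‖fderiv ℝ g x‖ ^ 2) (closedBall (0 : ℝ × ℝ) rs) :=
    hGc.continuousOn.integrableOn_compact (isCompact_closedBall 0 rs)
  have hAsub : polarCoord.symm '' (Icc w₀ rs ×ˢ Θ) ⊆ closedBall (0 : ℝ × ℝ) rs := hsq w₀ Θ hw₀pos.le
  have hLA := pi_mul_sq_le_log_mul_integral hg hm.le hw₀pos hw₀lt.le hΘm hΘsub hΘvol (fun θ _ => hcircle θ)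
    (fun θ hθ => hθ.2) hAsub hEint
  -- so `π m²/16 ≤ log(r★/w₀) · E`
  have hlog0 : 0 ≤ Real.log (rs / w₀) := Real.log_nonneg ((one_le_div hw₀pos).2 hw₀lt.le)
  have hkey : Real.pi * m ^ 2 / 16 ≤ Real.log (rs / w₀) * E :=
    hLA.trans (mul_le_mul_of_nonneg_left hE hlog0)
  have hpm : 0 < Real.pi * m ^ 2 / 16 := by positivity
  -- `E > 0`
  have hEpos : 0 < E := by
    by_contra hE0
    push Not at hE0
    have : Real.log (rs / w₀) * E ≤ 0 := mul_nonpos_of_nonneg_of_nonpos hlog0 hE0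
    linarith
  -- `x := π m²/(16E) ≤ log(r★/w₀)`, hence `G' ≥ (m/(4r★)) e^x`
  set x : ℝ := Real.pi * m ^ 2 / (16 * E) with hx
  have hxle : x ≤ Real.log (rs / w₀) := by
    rw [hx, div_le_iff₀ (by positivity)]
    have : Real.pi * m ^ 2 / 16 * 16 = Real.pi * m ^ 2 := by ring
    nlinarith
  have hexp : Real.exp x ≤ rs / w₀ := by
    have := Real.exp_le_exp.2 hxle
    rwa [Real.exp_log (div_pos hrs hw₀pos)] at this
  have hG'ge : m / (4 * rs) * Real.exp x ≤ G' := by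
    -- `e^x ≤ r★/w₀ = 4 G' r★/m`
    have h1 : rs / w₀ = 4 * G' * rs / m := by
      rw [hw₀]; field_simp
    rw [h1] at hexp
    rw [div_mul_eq_mul_div, div_le_iff₀ (by positivity)]
    rw [le_div_iff₀ hm] at hexp
    nlinarith
  -- dispatch on which term realises the max
  rcases le_total Gm (m / (2 * rs)) with hcase | hcase
  · right
    have hG'eq : G' = m / (2 * rs) := max_eq_right hcase
    rw [hG'eq] at hG'ge
    -- `(m/(4r★)) e^x ≤ m/(2r★)` ⇒ `e^x ≤ 2`
    have h2 : Real.exp x ≤ 2 := by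
      have h5 : m / (4 * rs) * Real.exp x = (m / rs) * (Real.exp x / 4) := by ring
      have h6 : m / (2 * rs) = (m / rs) * (1 / 2) := by ring
      rw [h5, h6] at hG'ge
      have h7 : 0 < m / rs := by positivity
      have h8 := le_of_mul_le_mul_left hG'ge h7
      linarith
    calc x = Real.log (Real.exp x) := (Real.log_exp x).symm
      _ ≤ Real.log 2 := Real.log_le_log (Real.exp_pos x) h2
  · left
    have hG'eq : G' = Gm := max_eq_left hcase
    rwa [hG'eq] at hG'ge


/-! ## Transfer to an affine isometric chart of a plane in an inner-product space -/

/-- The linear part `(h, k) ↦ h•u + k•v` of an orthonormal chart has operator norm `≤ √2` from the sup-normed `ℝ × ℝ`.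
[folklore] -/
theorem norm_smul_add_smul_le {H : Type*} [NormedAddCommGroup H] [InnerProductSpace ℝ H] {u v : H}
    (hu : ‖u‖ = 1) (hv : ‖v‖ = 1) (huv : ⟪u, v⟫ = 0) (q : ℝ × ℝ) :
    ‖q.1 • u + q.2 • v‖ ≤ Real.sqrt 2 * ‖q‖ := by
  have hsq : ‖q.1 • u + q.2 • v‖ ^ 2 = q.1 ^ 2 + q.2 ^ 2 := by
    rw [norm_add_sq_real, norm_smul, norm_smul, hu, hv, real_inner_smul_left, real_inner_smul_right, huv]
    simp [Real.norm_eq_abs, sq_abs]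
  have h1 : |q.1| ≤ ‖q‖ := by rw [Prod.norm_def]; exact le_max_left _ _
  have h2 : |q.2| ≤ ‖q‖ := by rw [Prod.norm_def]; exact le_max_right _ _
  have hq : 0 ≤ ‖q‖ := norm_nonneg _
  have h3 : q.1 ^ 2 + q.2 ^ 2 ≤ (Real.sqrt 2 * ‖q‖) ^ 2 := by
    rw [mul_pow, Real.sq_sqrt (by norm_num : (0:ℝ) ≤ 2)]
    nlinarith [sq_abs q.1, sq_abs q.2, abs_nonneg q.1, abs_nonneg q.2]
  exact le_of_pow_le_pow_left₀ two_ne_zero (by positivity) (hsq ▸ h3)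

/-- Points of the chart disc: `‖(r cos θ)•u + (r sin θ)•v‖ = |r|` for an orthonormal pair. [folklore] -/
theorem norm_chart_polar {H : Type*} [NormedAddCommGroup H] [InnerProductSpace ℝ H] {u v : H}
    (hu : ‖u‖ = 1) (hv : ‖v‖ = 1) (huv : ⟪u, v⟫ = 0) (r θ : ℝ) :
    ‖(r * Real.cos θ) • u + (r * Real.sin θ) • v‖ = |r| := by
  have hsq : ‖(r * Real.cos θ) • u + (r * Real.sin θ) • v‖ ^ 2 = r ^ 2 := by
    rw [norm_add_sq_real, norm_smul, norm_smul, hu, hv, real_inner_smul_left, real_inner_smul_right, huv]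
    simp only [Real.norm_eq_abs, mul_one, mul_zero, add_zero, sq_abs]
    nlinarith [Real.cos_sq_add_sin_sq θ]
  have h := congrArg Real.sqrt hsq
  rwa [Real.sqrt_sq (norm_nonneg _), Real.sqrt_sq_eq_abs] at h

/-- **THE CONDENSER CORE at an anomalous point of a `C¹` field, through an orthonormal chart of a plane.**
`V ∈ C¹(H, F)` (`H` a real inner-product space), `y₁ ∈ H` with `‖V y₁‖ ≥ m > 0`, `u ⊥ v` unit vectors, chart
`φ(a,b) = y₁ + a•u + b•v`; `‖DV‖ ≤ G_m` on `closedBall y₁ r★`; budgets `∫ ‖V∘φ‖² ≤ A`, `∫ ‖(DV)∘φ‖² ≤ E` over the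
sup-norm square `closedBall (0 : ℝ × ℝ) r★`; room `8A/(π m²) ≤ (3/4) r★²`.  Then
`(m/(4r★))·exp(π m²/(32E)) ≤ √2·G_m  ∨  π m²/(32E) ≤ log 2`
(the `√2` and the `32` come from the sup norm of `ℝ × ℝ`: `‖D(V∘φ)‖ ≤ √2‖DV∘φ‖`).
[folklore (length–area method); cite: ConstantinIgnatovaVicol2026Putative, §3.4.1 for the setting] -/
theorem exp_le_gradient_or_small_of_chart {H : Type*} [NormedAddCommGroup H] [InnerProductSpace ℝ H]
    {F : Type*} [NormedAddCommGroup F] [NormedSpace ℝ F] [CompleteSpace F]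
    {V : H → F} (hV : ContDiff ℝ 1 V) {y₁ u v : H} (hu : ‖u‖ = 1) (hv : ‖v‖ = 1) (huv : ⟪u, v⟫ = 0)
    {m rs Gm A E : ℝ} (hm : 0 < m) (hrs : 0 < rs) (h0 : m ≤ ‖V y₁‖)
    (hGm : ∀ z ∈ closedBall y₁ rs, ‖fderiv ℝ V z‖ ≤ Gm)
    (hA : ∫ p in closedBall (0 : ℝ × ℝ) rs, ‖V (y₁ + p.1 • u + p.2 • v)‖ ^ 2 ≤ A)
    (hE : ∫ p in closedBall (0 : ℝ × ℝ) rs, ‖fderiv ℝ V (y₁ + p.1 • u + p.2 • v)‖ ^ 2 ≤ E)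
    (hroom : 8 * A / (Real.pi * m ^ 2) ≤ 3 / 4 * rs ^ 2) :
    m / (4 * rs) * Real.exp (Real.pi * m ^ 2 / (32 * E)) ≤ Real.sqrt 2 * Gm ∨
      Real.pi * m ^ 2 / (32 * E) ≤ Real.log 2 := by
  -- the chart and its derivative
  set φ : ℝ × ℝ → H := fun p => y₁ + p.1 • u + p.2 • v with hφ
  set L : ℝ × ℝ →L[ℝ] H :=
    (ContinuousLinearMap.fst ℝ ℝ ℝ).smulRight u + (ContinuousLinearMap.snd ℝ ℝ ℝ).smulRight v with hL
  have hφ' : ∀ p, HasFDerivAt φ L p := by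
    intro p
    have h1 : HasFDerivAt (fun q : ℝ × ℝ => q.1) (ContinuousLinearMap.fst ℝ ℝ ℝ) p := hasFDerivAt_fst
    have h2 : HasFDerivAt (fun q : ℝ × ℝ => q.2) (ContinuousLinearMap.snd ℝ ℝ ℝ) p := hasFDerivAt_snd
    have h := ((h1.smul_const u).add (h2.smul_const v)).const_add y₁
    refine h.congr_of_eventuallyEq (Filter.Eventually.of_forall fun q => ?_)
    simp only [hφ, add_assoc, Pi.add_apply]
  have hφc : ContDiff ℝ 1 φ := by
    simp only [hφ]
    fun_prop
  have hLn : ‖L‖ ≤ Real.sqrt 2 := by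
    refine ContinuousLinearMap.opNorm_le_bound _ (Real.sqrt_nonneg _) fun q => ?_
    simpa [hL] using norm_smul_add_smul_le hu hv huv q
  set g : ℝ × ℝ → F := fun p => V (φ p) with hg
  have hgC : ContDiff ℝ 1 g := hV.comp hφc
  have hDg : ∀ p, fderiv ℝ g p = (fderiv ℝ V (φ p)).comp L := fun p =>
    ((hV.differentiable one_ne_zero _).hasFDerivAt.comp p (hφ' p)).fderiv
  have hDg_le : ∀ p, ‖fderiv ℝ g p‖ ≤ Real.sqrt 2 * ‖fderiv ℝ V (φ p)‖ := by
    intro p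
    rw [hDg p]
    refine (ContinuousLinearMap.opNorm_comp_le _ _).trans ?_
    rw [mul_comm]
    exact mul_le_mul_of_nonneg_right hLn (norm_nonneg _)
  -- hypotheses of the chart core
  have h0' : m ≤ ‖g 0‖ := by simpa [hg, hφ] using h0
  have hGm' : ∀ r ∈ Icc 0 rs, ∀ θ : ℝ, ‖fderiv ℝ g (polarCoord.symm (r, θ))‖ ≤ Real.sqrt 2 * Gm := by
    intro r hr θ
    refine (hDg_le _).trans (mul_le_mul_of_nonneg_left (hGm _ ?_) (Real.sqrt_nonneg _))
    rw [mem_closedBall, dist_eq_norm]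
    have : φ (polarCoord.symm (r, θ)) - y₁ = (r * Real.cos θ) • u + (r * Real.sin θ) • v := by
      simp only [hφ, polarCoord_symm_apply]; abel
    rw [this, norm_chart_polar hu hv huv, abs_of_nonneg hr.1]
    exact hr.2
  have hA' : ∫ p in closedBall (0 : ℝ × ℝ) rs, ‖g p‖ ^ 2 ≤ A := by
    simpa [hg, hφ] using hA
  -- the energy of `g` is at most `2E`
  have hcont2 : Continuous fun p : ℝ × ℝ => 2 * ‖fderiv ℝ V (φ p)‖ ^ 2 :=
    continuous_const.mul ((((hV.continuous_fderiv one_ne_zero).comp hφc.continuous).norm).pow 2)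
  have hE' : ∫ p in closedBall (0 : ℝ × ℝ) rs, ‖fderiv ℝ g p‖ ^ 2 ≤ 2 * E := by
    have h1 : ∫ p in closedBall (0 : ℝ × ℝ) rs, ‖fderiv ℝ g p‖ ^ 2 ≤
        ∫ p in closedBall (0 : ℝ × ℝ) rs, 2 * ‖fderiv ℝ V (φ p)‖ ^ 2 := by
      refine integral_mono_of_nonneg (Filter.Eventually.of_forall fun p => sq_nonneg _)
        (hcont2.continuousOn.integrableOn_compact (isCompact_closedBall 0 rs))
        (Filter.Eventually.of_forall fun p => ?_)
      have h := hDg_le p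
      have h2 : ‖fderiv ℝ g p‖ ^ 2 ≤ (Real.sqrt 2 * ‖fderiv ℝ V (φ p)‖) ^ 2 :=
        pow_le_pow_left₀ (norm_nonneg _) h 2
      rw [mul_pow, Real.sq_sqrt (by norm_num : (0:ℝ) ≤ 2)] at h2
      exact h2
    have h2 : ∫ p in closedBall (0 : ℝ × ℝ) rs, 2 * ‖fderiv ℝ V (φ p)‖ ^ 2 =
        2 * ∫ p in closedBall (0 : ℝ × ℝ) rs, ‖fderiv ℝ V (φ p)‖ ^ 2 :=
      integral_const_mul _ _
    have hE2 : ∫ p in closedBall (0 : ℝ × ℝ) rs, ‖fderiv ℝ V (φ p)‖ ^ 2 ≤ E := by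
      simpa [hφ] using hE
    linarith
  -- apply the chart core with `G_m ↦ √2 G_m`, `E ↦ 2E`
  have hcore := exp_le_gradient_or_small hgC hm hrs h0' hGm' hA' hE' hroom
  have e32 : Real.pi * m ^ 2 / (16 * (2 * E)) = Real.pi * m ^ 2 / (32 * E) := by ring
  rw [e32] at hcore
  exact hcore

end Summit.NavierStokesRegularity.NavierStokesRegularity.Theorems.PowerGaugeEulerLiouville.Condenser

end
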